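import Mathlib
import Summits.NavierStokesRegularity.FluidComputer.TransportGalerkinBilinearLoss
import HarnessLib

/-!
# The transport Galerkin model at SHIFTED levels `P_n = cubeProj (n + K)`: the KEEP/KILL sentences for head-block certificates (instab g18, cell `ns-blowup`, 2026-08-27)

HONEST FRAMING (human ruling D-0035): nothing here is a claim about Navier–Stokes blow-up.
WHAT THIS IS NOT: not NS evidence — the (β2) KEEP/KILL theorem schema
(`TransportGalerkinBilinearLoss.half_prediction_nsField''` / `decay_two_nsField''`) RE-INDEXED to
the Galerkin levels `cubeProj (n + K)`, `n ∈ ℕ`, for a fixed head size `K`.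

WHY. In the landed schema the certificate objects `G₁, G₂, G` must be `P_n`-compatible
(`⟪G w, P_n z⟫ = ⟪G (P_n w), z⟫`, i.e. `G` commutes with `P_n`) for EVERY cube truncation
`P_n = cubeProj n`, `n ≥ 0` — which forces `G` to be block-diagonal along the cube SHELLS
`|k|_∞ = n`. The cell's certificates are «head block ⊕ diagonal tail» weights (`HOME/instab/BETA2-SPEC.md`
§7; cap's D2 / 3-L / 3-L′ formats): a DENSE positive head block on the modes `|k|_∞ ≤ K` commutes with
`cubeProj m` only for `m ≥ K`. `Literature.Analysis.ODE.GalerkinConvergenceSetting` needs only a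
SEQUENCE of projections (uniformly bounded, nested, strongly convergent, box-preserving), so the levels
may start at `K` («re-index n ↦ n + K», BETA2-SPEC §1); this file carries that re-indexing through the
(β2) chain, with every per-level input (`oneSided_nsField`, the level generators, the diagonal weight's
`P_n`-compatibility) instantiated at level `n + K`:

* `galerkinSetting_nsField_shift` — the setting for `P_n = cubeProj (n + K)` from primitive data and
  RESIDENCE at the shifted levels;
* `half_prediction_nsField_shift` / `decay_two_nsField_shift` — KEEP/KILL with hypotheses = host + box
  data, residence at levels `n + K`, certificate objects `G₁, G₂, G` that are `cubeProj (n + K)`-compatible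
  and certified (h₁/h₂/hL) at levels `n + K`, the tail inequality on `ker cubeProj (n + K)`, `σ² < ∞`,
  eigen / seed data (eigen-consistency along `cubeProj (n + K)`).

General finite `d`, Hilbert proper `V`; Mathlib + the tree files cited; no new definitions.
-/

noncomputable section

namespace Summit.NavierStokesRegularity.FluidComputer.TransportGalerkinShift

open Set Filter Topology Finset RCLike
open Literature.Analysis.FunctionSpaces Literature.Analysis.FunctionSpaces.Lattice
open Literature.Analysis.FunctionSpaces.Torus Literature.Analysis.ODE
open Summit.NavierStokesRegularity.FluidComputer.GalerkinLatticePhaseSpace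
open Summit.NavierStokesRegularity.FluidComputer.TransportGalerkin
open Summit.NavierStokesRegularity.FluidComputer.TransportGalerkinBox
open Summit.NavierStokesRegularity.FluidComputer.TransportGalerkinOneSided
open Summit.NavierStokesRegularity.FluidComputer.TransportGalerkinContinuity
open Summit.NavierStokesRegularity.FluidComputer.TransportGalerkinLevelGenerators
open Summit.NavierStokesRegularity.FluidComputer.TransportGalerkinBilinearLoss
open Summit.NavierStokesRegularity.FluidComputer.GalerkinEmergenceCertificate
open scoped ENNReal NNReal ComplexConjugate InnerProductSpace

variable {d : Type*} [Fintype d] [DecidableEq d]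
variable {V : Type*} [NormedAddCommGroup V] [InnerProductSpace ℂ V] [CompleteSpace V] [ProperSpace V]
variable {ρ : (d → ℤ) → ℝ} {ν : ℝ} {Uv : (d → ℤ) → V} {π : d → (V →L[ℂ] ℂ)} {P : (d → ℤ) → (V →L[ℂ] V)}

/-! ## §1 The setting at shifted levels -/

/-- **The Galerkin convergence setting of the transport model at the levels `cubeProj (n + K)`**,
from primitive data (host, radii, `T ≥ 0`, `Z ⊆ W`) and RESIDENCE at those levels. -/
theorem galerkinSetting_nsField_shift (K : ℕ) (hν : 0 ≤ ν) (hUv : RapidDecay Uv)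
    (hUreal : ∀ j p, π j (Uv (-p)) = conj (π j (Uv p)))
    (hUdiv : ∑ j, freqDeriv j (fun p => π j (Uv p)) = 0) (hπ : ∀ j, ‖π j‖ ≤ 1)
    (hPsa : ∀ k, IsSelfAdjoint (P k)) (hPn : ∀ k, ‖P k‖ ≤ 1)
    (hρ0 : ∀ k, 0 ≤ ρ k) (hρ1 : Summable fun k => sobolevWeight 1 k * ρ k)
    (hρ2 : Summable fun k => (sobolevWeight 2 k * ρ k) ^ 2)
    {Z : Set (lp (fun _ : (d → ℤ) => V) 2)} {T : ℝ}
    {u : ℕ → lp (fun _ : (d → ℤ) => V) 2 → ℝ → lp (fun _ : (d → ℤ) => V) 2}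
    (hT : 0 ≤ T) (hZ : Z ⊆ box ρ π P)
    (sol_continuousOn : ∀ n, ∀ x ∈ Z, ContinuousOn (u n x) (Icc 0 T))
    (sol_init : ∀ n, ∀ x ∈ Z, u n x 0 = cubeProj (n + K) x)
    (sol_hasDerivAt : ∀ n, ∀ x ∈ Z, ∀ t ∈ Ioo 0 T,
      HasDerivAt (u n x) (cubeProj (n + K) (nsField ν Uv π P (u n x t))) t)
    (sol_mem : ∀ n, ∀ x ∈ Z, ∀ t ∈ Icc 0 T, u n x t ∈ box ρ π P)
    (sol_proj : ∀ n, ∀ x ∈ Z, ∀ t ∈ Icc 0 T, cubeProj (n + K) (u n x t) = u n x t) :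
    GalerkinConvergenceSetting (fun n => (cubeProj (n + K) :
        lp (fun _ : (d → ℤ) => V) 2 →L[ℝ] lp (fun _ : (d → ℤ) => V) 2))
      (nsField ν Uv π P) (box ρ π P) Z T
      ((6 * Real.pi * (∑ j, (symbNorm 2 (scal (fun p => π j (Uv p)) : (d → ℤ) → (V →L[ℂ] V))).toReal)
        + 2 * ((Fintype.card d : ℝ) * (2 * Real.pi)) *
          (∑' l, ENNReal.ofReal (sobolevWeight 3 l) * ‖Uv l‖ₑ).toReal)
        + 10 * Real.pi * (Fintype.card d : ℝ) * (∑' l, sobolevWeight 1 l * ρ l)) u where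
  nonneg := hT
  isCompact := isCompact_box (summable_sq_of_summable hρ0 hρ1) π P
  subset := hZ
  opNorm_le := ⟨1, fun _ => opNorm_lpProj_le _⟩
  tendsto_proj := fun w => (tendsto_lpProj_cube w).comp (tendsto_add_atTop_nat K)
  proj_comp := fun _ _ hnk w => lpProj_cube_nested_le (by omega) w
  mapsTo := fun n => mapsTo_cubeProj_box ρ π P (n + K)
  continuousOn := continuousOn_nsField hUv hπ hPn hρ0 hρ1 hρ2
  oneSided := fun n => oneSided_nsField hν hUv hUreal hUdiv hπ hPsa hPn hρ0 hρ1 (n + K)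
  sol_continuousOn := sol_continuousOn
  sol_init := sol_init
  sol_hasDerivAt := sol_hasDerivAt
  sol_mem := sol_mem
  sol_proj := sol_proj

/-! ## §2 KEEP / KILL at shifted levels -/

/-- **KEEP for the transport model at the levels `cubeProj (n + K)`** — hypotheses = host + box data,
residence at the shifted levels, the certificate objects `G₁, G₂, G` (symmetric, `cubeProj (n + K)`-
compatible) with THE CERTIFICATE at levels `n + K`, the tail inequality on `ker cubeProj (n + K)`,
`σ² < ∞`, eigen / seed data. -/
theorem half_prediction_nsField_shift (K : ℕ) (hν : 0 ≤ ν) (hUv : RapidDecay Uv)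
    (hUreal : ∀ j p, π j (Uv (-p)) = conj (π j (Uv p)))
    (hUdiv : ∑ j, freqDeriv j (fun p => π j (Uv p)) = 0) (hπ : ∀ j, ‖π j‖ ≤ 1)
    (hPsa : ∀ k, IsSelfAdjoint (P k)) (hPn : ∀ k, ‖P k‖ ≤ 1)
    (hρ0 : ∀ k, 0 ≤ ρ k) (hρ1 : Summable fun k => sobolevWeight 1 k * ρ k)
    (hρ2 : Summable fun k => (sobolevWeight 2 k * ρ k) ^ 2)
    {Z : Set (lp (fun _ : (d → ℤ) => V) 2)} {T : ℝ}
    {u : ℕ → lp (fun _ : (d → ℤ) => V) 2 → ℝ → lp (fun _ : (d → ℤ) => V) 2}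
    (hT : 0 ≤ T) (hZ : Z ⊆ box ρ π P)
    (sol_continuousOn : ∀ n, ∀ x ∈ Z, ContinuousOn (u n x) (Icc 0 T))
    (sol_init : ∀ n, ∀ x ∈ Z, u n x 0 = cubeProj (n + K) x)
    (sol_hasDerivAt : ∀ n, ∀ x ∈ Z, ∀ t ∈ Ioo 0 T,
      HasDerivAt (u n x) (cubeProj (n + K) (nsField ν Uv π P (u n x t))) t)
    (sol_mem : ∀ n, ∀ x ∈ Z, ∀ t ∈ Icc 0 T, u n x t ∈ box ρ π P)
    (sol_proj : ∀ n, ∀ x ∈ Z, ∀ t ∈ Icc 0 T, cubeProj (n + K) (u n x t) = u n x t)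
    {μ : ℝ}
    (hσ : ∑' l : d → ℤ, ENNReal.ofReal (sobolevWeight (-2) l ^ 2) < ∞)
    {G₁ G₂ G : lp (fun _ : (d → ℤ) => V) 2 →L[ℝ] lp (fun _ : (d → ℤ) => V) 2}
    (hG₁ : ∀ x y : lp (fun _ : (d → ℤ) => V) 2, ⟪G₁ x, y⟫_ℂ = ⟪x, G₁ y⟫_ℂ)
    (hG₂ : ∀ x y : lp (fun _ : (d → ℤ) => V) 2, ⟪G₂ x, y⟫_ℂ = ⟪x, G₂ y⟫_ℂ)
    (hG : ∀ x y : lp (fun _ : (d → ℤ) => V) 2, ⟪G x, y⟫_ℂ = ⟪x, G y⟫_ℂ)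
    (hG₁P : ∀ n, ∀ w z : lp (fun _ : (d → ℤ) => V) 2, ⟪G₁ w, cubeProj (n + K) z⟫_ℂ = ⟪G₁ (cubeProj (n + K) w), z⟫_ℂ)
    (hG₂P : ∀ n, ∀ w z : lp (fun _ : (d → ℤ) => V) 2, ⟪G₂ w, cubeProj (n + K) z⟫_ℂ = ⟪G₂ (cubeProj (n + K) w), z⟫_ℂ)
    (hGP : ∀ n, ∀ w z : lp (fun _ : (d → ℤ) => V) 2, ⟪G w, cubeProj (n + K) z⟫_ℂ = ⟪G (cubeProj (n + K) w), z⟫_ℂ)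
    (hG₁pos : ∀ x : lp (fun _ : (d → ℤ) => V) 2, 0 ≤ re ⟪G₁ x, x⟫_ℂ) {ω c m₂ M₁ : ℝ} (hc : 0 < c)
    (hm₂ : 0 < m₂) (hM₁ : 0 ≤ M₁)
    (hm₂' : ∀ x : lp (fun _ : (d → ℤ) => V) 2, m₂ * ‖x‖ ^ 2 ≤ re ⟪G₂ x, x⟫_ℂ)
    (hM₁' : ∀ x : lp (fun _ : (d → ℤ) => V) 2, re ⟪G₁ x, x⟫_ℂ ≤ M₁ * (eNormSq (-1) (⇑x)).toReal)
    {m M ω₁ : ℝ} (hm0 : 0 < m) (hm : ∀ x : lp (fun _ : (d → ℤ) => V) 2, m * ‖x‖ ^ 2 ≤ re ⟪G x, x⟫_ℂ)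
    (hM : ∀ x : lp (fun _ : (d → ℤ) => V) 2, re ⟪G x, x⟫_ℂ ≤ M * ‖x‖ ^ 2)
    (h₁ : ∀ n, ∀ w : lp (fun _ : (d → ℤ) => V) 2,
      2 * re ⟪G₁ (cubeProj (n + K) w), linOp ν Uv π P (cubeProj (n + K) w)⟫_ℂ + c * re ⟪G₂ (cubeProj (n + K) w), cubeProj (n + K) w⟫_ℂ ≤
        2 * ω * re ⟪G₁ (cubeProj (n + K) w), cubeProj (n + K) w⟫_ℂ)
    (h₂ : ∀ n, ∀ w : lp (fun _ : (d → ℤ) => V) 2,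
      re ⟪G₂ (cubeProj (n + K) w), linOp ν Uv π P (cubeProj (n + K) w)⟫_ℂ ≤ ω * re ⟪G₂ (cubeProj (n + K) w), cubeProj (n + K) w⟫_ℂ)
    (hL : ∀ n, ∀ w : lp (fun _ : (d → ℤ) => V) 2,
      re ⟪G (cubeProj (n + K) w), linOp ν Uv π P (cubeProj (n + K) w)⟫_ℂ ≤ ω₁ * re ⟪G (cubeProj (n + K) w), cubeProj (n + K) w⟫_ℂ)
    (hμ₁ : μ ≤ ω₁) (hμ₂ : μ ≤ ω)
    (htail : ∀ n, ∀ q : lp (fun _ : (d → ℤ) => V) 2, cubeProj (n + K) q = 0 →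
      2 * μ * re ⟪G₁ q, q⟫_ℂ + c * re ⟪G₂ q, q⟫_ℂ ≤ 2 * ω * re ⟪G₁ q, q⟫_ℂ)
    {v : lp (fun _ : (d → ℤ) => V) 2} (hv1 : ‖v‖ = 1) {lam ε : ℝ} (hgap : ω < 2 * lam)
    (hlam : 0 ≤ lam) (hε : 0 < ε) (hx : ε • v ∈ Z)
    (hres : Tendsto (fun n => ‖cubeProj (n + K) (linOp ν Uv π P (cubeProj (n + K) v)) - lam • cubeProj (n + K) v‖)
      atTop (𝓝 0))
    {C' : ℝ}
    (hCC' : Real.sqrt (M₁ / (c * m₂)) * (2 * ((Fintype.card d : ℝ) * (2 * Real.pi)) *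
        Real.sqrt ((∑' l : d → ℤ, ENNReal.ofReal (sobolevWeight (-2) l ^ 2)).toReal)) * Real.sqrt (Real.pi / (2 * lam - ω)) < C')
    (hsmall : ∀ t ∈ Icc 0 T, C' * (3 / 2 : ℝ) ^ 2 * (ε * Real.exp (lam * t)) < 3 / 2 - 1)
    {w : ℝ → lp (fun _ : (d → ℤ) => V) 2} (hw : ContinuousOn w (Icc 0 T)) (hw0 : w 0 = ε • v)
    (hw' : ∀ t ∈ Ioo 0 T, HasDerivAt w (nsField ν Uv π P (w t)) t) (hwW : ∀ t ∈ Icc 0 T, w t ∈ box ρ π P)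
    {t : ℝ} (ht : t ∈ Icc 0 T) (hχ : ε * Real.exp (lam * t) ≤ 2 / (9 * C')) :
    ε * Real.exp (lam * t) / 2 ≤ ‖w t‖ := by
  obtain ⟨D, hD⟩ := exists_diagWeight (d := d) (V := V)
  have hDP : ∀ n, ∀ w z : lp (fun _ : (d → ℤ) => V) 2,
      ⟪D w, cubeProj (n + K) z⟫_ℂ = ⟪D (cubeProj (n + K) w), z⟫_ℂ := fun n w z => by
    rw [inner_eq_pairing, inner_eq_pairing, hD, hD, pairing_wmul_neg_two_cubeProj]
  have hDre : ∀ x : lp (fun _ : (d → ℤ) => V) 2, re ⟪D x, x⟫_ℂ = (eNormSq (-1) (⇑x)).toReal := fun x => by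
    rw [show re ⟪D x, x⟫_ℂ = (⟪D x, x⟫_ℂ).re from rfl, inner_eq_pairing, hD, re_pairing_wmul_neg_two_self]
  have hDnn : ∀ x : lp (fun _ : (d → ℤ) => V) 2, 0 ≤ re ⟪D x, x⟫_ℂ := fun x => by
    rw [hDre]; exact ENNReal.toReal_nonneg
  have hM₁D : ∀ x : lp (fun _ : (d → ℤ) => V) 2, re ⟪G₁ x, x⟫_ℂ ≤ M₁ * re ⟪D x, x⟫_ℂ := fun x => by
    rw [hDre]; exact hM₁' x
  have hcalg : 0 ≤ 2 * ((Fintype.card d : ℝ) * (2 * Real.pi)) *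
      Real.sqrt ((∑' l : d → ℤ, ENNReal.ofReal (sobolevWeight (-2) l ^ 2)).toReal) := by positivity
  obtain ⟨An, hAn⟩ := exists_levelGenerators (ν := ν) (P := P) hUv hπ hPn μ
  have hfix : ∀ n, An (n + K) (cubeProj (n + K) v) = cubeProj (n + K) (linOp ν Uv π P (cubeProj (n + K) v)) :=
    fun n => by rw [hAn, lpProj_idem, sub_self, smul_zero, add_zero]
  exact half_prediction_of_head_tail_certificate (𝕜 := ℂ)
    (galerkinSetting_nsField_shift K hν hUv hUreal hUdiv hπ hPsa hPn hρ0 hρ1 hρ2 hT hZ sol_continuousOn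
      sol_init sol_hasDerivAt sol_mem sol_proj)
    (A := linOp ν Uv π P) (B := bilOp π P) (fun x _ => nsField_eq ν Uv π P x) (fun n => An (n + K))
    (fun n w => hAn (n + K) w) hG₁ hG₂ hG hG₁P hG₂P hDP hGP hG₁pos hc hm₂ hM₁ hm₂' hDnn hM₁D hm0 hm hM h₁ h₂
    hL hμ₁ hμ₂ htail hcalg (bilinear_loss hπ hPn hσ hD) hv1 hgap hlam hε hx
    (hres.congr fun n => by rw [hfix]) hCC' hsmall hw hw0 hw' hwW ht hχ

/-- **KILL for the transport model at the levels `cubeProj (n + K)`**, same discharges. -/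
theorem decay_two_nsField_shift (K : ℕ) (hν : 0 ≤ ν) (hUv : RapidDecay Uv)
    (hUreal : ∀ j p, π j (Uv (-p)) = conj (π j (Uv p)))
    (hUdiv : ∑ j, freqDeriv j (fun p => π j (Uv p)) = 0) (hπ : ∀ j, ‖π j‖ ≤ 1)
    (hPsa : ∀ k, IsSelfAdjoint (P k)) (hPn : ∀ k, ‖P k‖ ≤ 1)
    (hρ0 : ∀ k, 0 ≤ ρ k) (hρ1 : Summable fun k => sobolevWeight 1 k * ρ k)
    (hρ2 : Summable fun k => (sobolevWeight 2 k * ρ k) ^ 2)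
    {Z : Set (lp (fun _ : (d → ℤ) => V) 2)} {T : ℝ}
    {u : ℕ → lp (fun _ : (d → ℤ) => V) 2 → ℝ → lp (fun _ : (d → ℤ) => V) 2}
    (hT : 0 ≤ T) (hZ : Z ⊆ box ρ π P)
    (sol_continuousOn : ∀ n, ∀ x ∈ Z, ContinuousOn (u n x) (Icc 0 T))
    (sol_init : ∀ n, ∀ x ∈ Z, u n x 0 = cubeProj (n + K) x)
    (sol_hasDerivAt : ∀ n, ∀ x ∈ Z, ∀ t ∈ Ioo 0 T,
      HasDerivAt (u n x) (cubeProj (n + K) (nsField ν Uv π P (u n x t))) t)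
    (sol_mem : ∀ n, ∀ x ∈ Z, ∀ t ∈ Icc 0 T, u n x t ∈ box ρ π P)
    (sol_proj : ∀ n, ∀ x ∈ Z, ∀ t ∈ Icc 0 T, cubeProj (n + K) (u n x t) = u n x t)
    {μ : ℝ}
    (hσ : ∑' l : d → ℤ, ENNReal.ofReal (sobolevWeight (-2) l ^ 2) < ∞)
    {G₁ G₂ G : lp (fun _ : (d → ℤ) => V) 2 →L[ℝ] lp (fun _ : (d → ℤ) => V) 2}
    (hG₁ : ∀ x y : lp (fun _ : (d → ℤ) => V) 2, ⟪G₁ x, y⟫_ℂ = ⟪x, G₁ y⟫_ℂ)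
    (hG₂ : ∀ x y : lp (fun _ : (d → ℤ) => V) 2, ⟪G₂ x, y⟫_ℂ = ⟪x, G₂ y⟫_ℂ)
    (hG : ∀ x y : lp (fun _ : (d → ℤ) => V) 2, ⟪G x, y⟫_ℂ = ⟪x, G y⟫_ℂ)
    (hG₁P : ∀ n, ∀ w z : lp (fun _ : (d → ℤ) => V) 2, ⟪G₁ w, cubeProj (n + K) z⟫_ℂ = ⟪G₁ (cubeProj (n + K) w), z⟫_ℂ)
    (hG₂P : ∀ n, ∀ w z : lp (fun _ : (d → ℤ) => V) 2, ⟪G₂ w, cubeProj (n + K) z⟫_ℂ = ⟪G₂ (cubeProj (n + K) w), z⟫_ℂ)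
    (hGP : ∀ n, ∀ w z : lp (fun _ : (d → ℤ) => V) 2, ⟪G w, cubeProj (n + K) z⟫_ℂ = ⟪G (cubeProj (n + K) w), z⟫_ℂ)
    (hG₁pos : ∀ x : lp (fun _ : (d → ℤ) => V) 2, 0 ≤ re ⟪G₁ x, x⟫_ℂ) {ω c m₂ M₁ : ℝ} (hc : 0 < c)
    (hm₂ : 0 < m₂) (hM₁ : 0 ≤ M₁)
    (hm₂' : ∀ x : lp (fun _ : (d → ℤ) => V) 2, m₂ * ‖x‖ ^ 2 ≤ re ⟪G₂ x, x⟫_ℂ)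
    (hM₁' : ∀ x : lp (fun _ : (d → ℤ) => V) 2, re ⟪G₁ x, x⟫_ℂ ≤ M₁ * (eNormSq (-1) (⇑x)).toReal)
    {m M ω₁ : ℝ} (hm0 : 0 < m) (hm : ∀ x : lp (fun _ : (d → ℤ) => V) 2, m * ‖x‖ ^ 2 ≤ re ⟪G x, x⟫_ℂ)
    (hM : ∀ x : lp (fun _ : (d → ℤ) => V) 2, re ⟪G x, x⟫_ℂ ≤ M * ‖x‖ ^ 2)
    (h₁ : ∀ n, ∀ w : lp (fun _ : (d → ℤ) => V) 2,
      2 * re ⟪G₁ (cubeProj (n + K) w), linOp ν Uv π P (cubeProj (n + K) w)⟫_ℂ + c * re ⟪G₂ (cubeProj (n + K) w), cubeProj (n + K) w⟫_ℂ ≤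
        2 * ω * re ⟪G₁ (cubeProj (n + K) w), cubeProj (n + K) w⟫_ℂ)
    (h₂ : ∀ n, ∀ w : lp (fun _ : (d → ℤ) => V) 2,
      re ⟪G₂ (cubeProj (n + K) w), linOp ν Uv π P (cubeProj (n + K) w)⟫_ℂ ≤ ω * re ⟪G₂ (cubeProj (n + K) w), cubeProj (n + K) w⟫_ℂ)
    (hL : ∀ n, ∀ w : lp (fun _ : (d → ℤ) => V) 2,
      re ⟪G (cubeProj (n + K) w), linOp ν Uv π P (cubeProj (n + K) w)⟫_ℂ ≤ ω₁ * re ⟪G (cubeProj (n + K) w), cubeProj (n + K) w⟫_ℂ)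
    (hμ₁ : μ ≤ ω₁) (hμ₂ : μ ≤ ω)
    (htail : ∀ n, ∀ q : lp (fun _ : (d → ℤ) => V) 2, cubeProj (n + K) q = 0 →
      2 * μ * re ⟪G₁ q, q⟫_ℂ + c * re ⟪G₂ q, q⟫_ℂ ≤ 2 * ω * re ⟪G₁ q, q⟫_ℂ)
    {lam : ℝ} (hgap : ω < 2 * lam) (hlam : lam ≤ 0) (hrate : ω₁ ≤ lam)
    {x : lp (fun _ : (d → ℤ) => V) 2} (hxZ : x ∈ Z) {ε : ℝ} (hε : 0 < ε)
    (hseed : Real.sqrt (M / m) * ‖x‖ < ε)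
    (hbasin : 4 * (Real.sqrt (M₁ / (c * m₂)) * (2 * ((Fintype.card d : ℝ) * (2 * Real.pi)) *
        Real.sqrt ((∑' l : d → ℤ, ENNReal.ofReal (sobolevWeight (-2) l ^ 2)).toReal)) * Real.sqrt (Real.pi / (2 * lam - ω))) * ε < 1)
    {w : ℝ → lp (fun _ : (d → ℤ) => V) 2} (hw : ContinuousOn w (Icc 0 T)) (hw0 : w 0 = x)
    (hw' : ∀ t ∈ Ioo 0 T, HasDerivAt w (nsField ν Uv π P (w t)) t)
    (hwW : ∀ t ∈ Icc 0 T, w t ∈ box ρ π P) :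
    ∀ t ∈ Icc 0 T, ‖w t‖ ≤ 2 * (ε * Real.exp (lam * t)) := by
  obtain ⟨D, hD⟩ := exists_diagWeight (d := d) (V := V)
  have hDP : ∀ n, ∀ w z : lp (fun _ : (d → ℤ) => V) 2,
      ⟪D w, cubeProj (n + K) z⟫_ℂ = ⟪D (cubeProj (n + K) w), z⟫_ℂ := fun n w z => by
    rw [inner_eq_pairing, inner_eq_pairing, hD, hD, pairing_wmul_neg_two_cubeProj]
  have hDre : ∀ x : lp (fun _ : (d → ℤ) => V) 2, re ⟪D x, x⟫_ℂ = (eNormSq (-1) (⇑x)).toReal := fun x => by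
    rw [show re ⟪D x, x⟫_ℂ = (⟪D x, x⟫_ℂ).re from rfl, inner_eq_pairing, hD, re_pairing_wmul_neg_two_self]
  have hDnn : ∀ x : lp (fun _ : (d → ℤ) => V) 2, 0 ≤ re ⟪D x, x⟫_ℂ := fun x => by
    rw [hDre]; exact ENNReal.toReal_nonneg
  have hM₁D : ∀ x : lp (fun _ : (d → ℤ) => V) 2, re ⟪G₁ x, x⟫_ℂ ≤ M₁ * re ⟪D x, x⟫_ℂ := fun x => by
    rw [hDre]; exact hM₁' x
  have hcalg : 0 ≤ 2 * ((Fintype.card d : ℝ) * (2 * Real.pi)) *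
      Real.sqrt ((∑' l : d → ℤ, ENNReal.ofReal (sobolevWeight (-2) l ^ 2)).toReal) := by positivity
  obtain ⟨An, hAn⟩ := exists_levelGenerators (ν := ν) (P := P) hUv hπ hPn μ
  exact decay_two_of_head_tail_certificate (𝕜 := ℂ)
    (galerkinSetting_nsField_shift K hν hUv hUreal hUdiv hπ hPsa hPn hρ0 hρ1 hρ2 hT hZ sol_continuousOn
      sol_init sol_hasDerivAt sol_mem sol_proj)
    (A := linOp ν Uv π P) (B := bilOp π P) (fun x _ => nsField_eq ν Uv π P x) (fun n => An (n + K))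
    (fun n w => hAn (n + K) w) hG₁ hG₂ hG hG₁P hG₂P hDP hGP hG₁pos hc hm₂ hM₁ hm₂' hDnn hM₁D hm0 hm hM h₁ h₂
    hL hμ₁ hμ₂ htail hgap hlam hrate hcalg (bilinear_loss hπ hPn hσ hD) hxZ hε hseed hbasin hw hw0 hw' hwW

end Summit.NavierStokesRegularity.FluidComputer.TransportGalerkinShift

end
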